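import Literature.Computability.Complexity.DecisionTreeQueries
import Mathlib.Logic.Equiv.Fin.Basic
import Mathlib.Algebra.BigOperators.Fin
import Mathlib.Data.Real.Basic
import HarnessLib

/-!
# Crux `PseudoBoundedAA` (stmt-QuantumAdvantage-15237, route SosSandwich) — block calculus for STRUCTURAL certificates on
# the classical corner: Fubini over `{0,1}^{m+n}`, and decision trees embedded in a block (`DecisionTree.comap` along
# `Fin.castAdd` / `Fin.natAdd`)

Support file (`--supports stmt-QuantumAdvantage-15237`, def-free).  The census's `L²`-OSSS question on the classical corner
`R_T` (`16·Var[p]² ≤ C₀·Σⱼ δ̄ⱼ Infⱼ[p]` for mixtures of decision trees) has, as of this hand, the lower bound `C₀ ≥ 8/7` in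
kernel (`…ClassicalCornerL2OSSSLowerBound`, a 32-point brute-force certificate) and `C₀ ≥ 6/5, 32/27, …, ≈ 1.67` on paper
from the GATED (soft-address) COMPOSITION family `G ▷ (M₁, M₂)` (hands' evidence SOFT-ADDRESS-RECURSION-15237.md): run a
selector mixture on a block `S`, then one of two mixtures on disjoint blocks `U₁`, `U₂`.  Its smallest member beating `8/7`
lives on `11 = 3 + (4 + 4)` bits, out of reach of point-by-point evaluation; the certificates must instead be computed
BLOCKWISE.  This file supplies the block calculus, stated for the tree's `DecisionTree` / `queries` vocabulary:

* `sum_cube_append` — Fubini: `Σ_{x ∈ {0,1}^{m+n}} F(x) = Σ_{y ∈ {0,1}^m} Σ_{z ∈ {0,1}^n} F(y ⧺ z)` (`y ⧺ z = Fin.append y z`);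
* `append_update_castAdd`, `append_update_natAdd` — a bit flip inside a block is a block-local flip;
* `eval_comap_castAdd_append`, `eval_comap_natAdd_append` — a tree embedded in the left/right block reads only that block;
* `queries_comap` — the query set of a reindexed tree is the image of the query set; hence
  `castAdd_mem_queries_comap_castAdd_iff`, `natAdd_not_mem_queries_comap_castAdd` (and the mirror pair), and the query-weight
  identities `card_filter_castAdd_mem_queries_comap_castAdd` (`#{x : castAdd i ∈ Q} = 2^n · #{y : i ∈ Q}`),
  `card_filter_natAdd_mem_queries_comap_castAdd` (`= 0`).

Honest label: elementary infrastructure (no inequality about the conjecture is proved here); no registered stub, crux or summit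
is closed.  Sources: H. Buhrman, R. de Wolf, *Complexity measures and decision tree complexity*, TCS 288 (2002) §2.1
(decision trees, restrictions); R. O'Donnell, *Analysis of Boolean Functions* (2014) §8.6.
-/

set_option linter.dupNamespace false

namespace Summit.QuantumAdvantage.QuantumAdvantage.Theorems.SosSandwich

open Finset Function
open Literature.Computability.Complexity

namespace ClassicalCornerBlockCalculus

variable {m n : ℕ}

/-! ### Fubini on the cube `{0,1}^{m+n} ≃ {0,1}^m × {0,1}^n` -/

/-- **Fubini for the Boolean cube.** `Σ_{x : Fin (m+n) → Bool} F x = Σ_y Σ_z F (Fin.append y z)`. [folklore] -/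
theorem sum_cube_append {M : Type*} [AddCommMonoid M] (F : (Fin (m + n) → Bool) → M) :
    ∑ x : Fin (m + n) → Bool, F x = ∑ y : Fin m → Bool, ∑ z : Fin n → Bool, F (Fin.append y z) := by
  rw [← Fintype.sum_prod_type']
  exact (Fintype.sum_equiv (Fin.appendEquiv m n) (fun q => F (Fin.append q.1 q.2)) F fun _ => rfl).symm

/-- The left block of `Fin.append y z` is `y`. [folklore] -/
theorem append_comp_castAdd {α : Type*} (y : Fin m → α) (z : Fin n → α) :
    Fin.append y z ∘ Fin.castAdd n = y :=
  funext fun i => Fin.append_left y z i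

/-- The right block of `Fin.append y z` is `z`. [folklore] -/
theorem append_comp_natAdd {α : Type*} (y : Fin m → α) (z : Fin n → α) :
    Fin.append y z ∘ Fin.natAdd m = z :=
  funext fun j => Fin.append_right y z j

/-- Left-block and right-block coordinates are distinct. [folklore] -/
theorem castAdd_ne_natAdd (i : Fin m) (j : Fin n) : Fin.castAdd n i ≠ Fin.natAdd m j := by
  intro h
  have h' := congrArg Fin.val h
  rw [Fin.val_castAdd, Fin.val_natAdd] at h'
  have := i.2
  omega

/-- Flipping a left-block coordinate of `y ⧺ z` flips it in `y`. [folklore] -/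
theorem append_update_castAdd {α : Type*} (y : Fin m → α) (z : Fin n → α) (i : Fin m) (a : α) :
    update (Fin.append y z) (Fin.castAdd n i) a = Fin.append (update y i a) z := by
  funext k
  refine Fin.addCases (fun k => ?_) (fun l => ?_) k
  · rw [Fin.append_left]
    by_cases hk : k = i
    · subst hk; rw [update_self, update_self]
    · rw [update_of_ne hk, update_of_ne (fun h => hk (Fin.castAdd_injective _ _ h)), Fin.append_left]
  · rw [Fin.append_right, update_of_ne (fun h => castAdd_ne_natAdd i l h.symm), Fin.append_right]

/-- Flipping a right-block coordinate of `y ⧺ z` flips it in `z`. [folklore] -/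
theorem append_update_natAdd {α : Type*} (y : Fin m → α) (z : Fin n → α) (j : Fin n) (a : α) :
    update (Fin.append y z) (Fin.natAdd m j) a = Fin.append y (update z j a) := by
  funext k
  refine Fin.addCases (fun k => ?_) (fun l => ?_) k
  · rw [Fin.append_left, update_of_ne (castAdd_ne_natAdd k j), Fin.append_left]
  · rw [Fin.append_right]
    by_cases hl : l = j
    · subst hl; rw [update_self, update_self]
    · rw [update_of_ne hl, update_of_ne (fun h => hl (Fin.natAdd_injective _ _ h)), Fin.append_right]

/-! ### Trees embedded in a block -/

/-- A tree embedded in the left block evaluates on the left block. [cite: Wolf2002, §2.1] -/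
theorem eval_comap_castAdd_append (T : DecisionTree m) (y : Fin m → Bool) (z : Fin n → Bool) :
    (T.comap (Fin.castAdd n)).eval (Fin.append y z) = T.eval y := by
  rw [DecisionTree.eval_comap, append_comp_castAdd]

/-- A tree embedded in the right block evaluates on the right block. [cite: Wolf2002, §2.1] -/
theorem eval_comap_natAdd_append (T : DecisionTree n) (y : Fin m → Bool) (z : Fin n → Bool) :
    (T.comap (Fin.natAdd m)).eval (Fin.append y z) = T.eval z := by
  rw [DecisionTree.eval_comap, append_comp_natAdd]

/-- **Queries of a reindexed tree**: `(T.comap g).queries x = g '' (T.queries (x ∘ g))`. [cite: Wolf2002, §2.1] -/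
theorem queries_comap {k l : ℕ} (g : Fin k → Fin l) (T : DecisionTree k) (x : Fin l → Bool) :
    (T.comap g).queries x = (T.queries (x ∘ g)).image g := by
  induction T with
  | leaf b => simp [DecisionTree.comap]
  | query i t₀ t₁ ih₀ ih₁ =>
    simp only [DecisionTree.comap, DecisionTree.queries_query, Function.comp_apply, ih₀, ih₁]
    by_cases h : x (g i) = true
    · rw [if_pos h, if_pos h, Finset.image_insert]
    · rw [if_neg h, if_neg h, Finset.image_insert]

/-- A left-block tree queries the left-block coordinate `i` iff the original tree queries `i`. [cite: Wolf2002, §2.1] -/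
theorem castAdd_mem_queries_comap_castAdd_iff (T : DecisionTree m) (y : Fin m → Bool) (z : Fin n → Bool) (i : Fin m) :
    Fin.castAdd n i ∈ (T.comap (Fin.castAdd n)).queries (Fin.append y z) ↔ i ∈ T.queries y := by
  rw [queries_comap, append_comp_castAdd, Finset.mem_image]
  exact ⟨fun ⟨j, hj, h⟩ => Fin.castAdd_injective _ _ h ▸ hj, fun h => ⟨i, h, rfl⟩⟩

/-- A left-block tree never queries a right-block coordinate. [cite: Wolf2002, §2.1] -/
theorem natAdd_not_mem_queries_comap_castAdd (T : DecisionTree m) (x : Fin (m + n) → Bool) (j : Fin n) :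
    Fin.natAdd m j ∉ (T.comap (Fin.castAdd n)).queries x := by
  rw [queries_comap, Finset.mem_image]
  rintro ⟨i, -, h⟩
  exact castAdd_ne_natAdd i j h

/-- A right-block tree queries the right-block coordinate `j` iff the original tree queries `j`. [cite: Wolf2002, §2.1] -/
theorem natAdd_mem_queries_comap_natAdd_iff (T : DecisionTree n) (y : Fin m → Bool) (z : Fin n → Bool) (j : Fin n) :
    Fin.natAdd m j ∈ (T.comap (Fin.natAdd m)).queries (Fin.append y z) ↔ j ∈ T.queries z := by
  rw [queries_comap, append_comp_natAdd, Finset.mem_image]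
  exact ⟨fun ⟨l, hl, h⟩ => Fin.natAdd_injective _ _ h ▸ hl, fun h => ⟨j, h, rfl⟩⟩

/-- A right-block tree never queries a left-block coordinate. [cite: Wolf2002, §2.1] -/
theorem castAdd_not_mem_queries_comap_natAdd (T : DecisionTree n) (x : Fin (m + n) → Bool) (i : Fin m) :
    Fin.castAdd n i ∉ (T.comap (Fin.natAdd m)).queries x := by
  rw [queries_comap, Finset.mem_image]
  rintro ⟨l, -, h⟩
  exact castAdd_ne_natAdd i l h.symm

/-! ### Query weights of embedded trees -/

/-- The number of points of `{0,1}^n` as a real number. [folklore] -/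
theorem sum_cube_const_one : ∑ _z : Fin n → Bool, (1 : ℝ) = (2 : ℝ) ^ n := by
  rw [Finset.sum_const, Finset.card_univ, Fintype.card_fun, Fintype.card_bool, Fintype.card_fin, nsmul_eq_mul, mul_one]
  push_cast
  rfl

/-- **Query weight of a left-block tree at a left-block coordinate**: `#{x ∈ {0,1}^{m+n} : castAdd i ∈ Q(x)} =
2^n · #{y ∈ {0,1}^m : i ∈ Q(y)}`. [cite: Wolf2002, §2.1] -/
theorem card_filter_castAdd_mem_queries_comap_castAdd (T : DecisionTree m) (i : Fin m) :
    ((Finset.univ.filter fun x : Fin (m + n) → Bool =>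
        Fin.castAdd n i ∈ (T.comap (Fin.castAdd n)).queries x).card : ℝ) =
      (2 : ℝ) ^ n * ((Finset.univ.filter fun y : Fin m → Bool => i ∈ T.queries y).card : ℝ) := by
  classical
  rw [Finset.natCast_card_filter, Finset.natCast_card_filter, sum_cube_append, Finset.mul_sum]
  refine Finset.sum_congr rfl fun y _ => ?_
  simp_rw [castAdd_mem_queries_comap_castAdd_iff]
  rw [Finset.sum_const, Finset.card_univ, Fintype.card_fun, Fintype.card_bool, Fintype.card_fin, nsmul_eq_mul]
  push_cast
  rfl

/-- **A left-block tree has query weight `0` at every right-block coordinate.** [cite: Wolf2002, §2.1] -/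
theorem card_filter_natAdd_mem_queries_comap_castAdd (T : DecisionTree m) (j : Fin n) :
    ((Finset.univ.filter fun x : Fin (m + n) → Bool =>
        Fin.natAdd m j ∈ (T.comap (Fin.castAdd n)).queries x).card : ℝ) = 0 := by
  rw [Nat.cast_eq_zero, Finset.card_eq_zero, Finset.filter_eq_empty_iff]
  exact fun x _ => natAdd_not_mem_queries_comap_castAdd T x j

/-- **Query weight of a right-block tree at a right-block coordinate**: `#{x : natAdd j ∈ Q(x)} = 2^m · #{z : j ∈ Q(z)}`.
[cite: Wolf2002, §2.1] -/
theorem card_filter_natAdd_mem_queries_comap_natAdd (T : DecisionTree n) (j : Fin n) :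
    ((Finset.univ.filter fun x : Fin (m + n) → Bool =>
        Fin.natAdd m j ∈ (T.comap (Fin.natAdd m)).queries x).card : ℝ) =
      (2 : ℝ) ^ m * ((Finset.univ.filter fun z : Fin n → Bool => j ∈ T.queries z).card : ℝ) := by
  classical
  rw [Finset.natCast_card_filter, Finset.natCast_card_filter, sum_cube_append]
  simp_rw [natAdd_mem_queries_comap_natAdd_iff]
  rw [Finset.sum_const, Finset.card_univ, Fintype.card_fun, Fintype.card_bool, Fintype.card_fin, nsmul_eq_mul]
  push_cast
  rfl

/-- **A right-block tree has query weight `0` at every left-block coordinate.** [cite: Wolf2002, §2.1] -/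
theorem card_filter_castAdd_mem_queries_comap_natAdd (T : DecisionTree n) (i : Fin m) :
    ((Finset.univ.filter fun x : Fin (m + n) → Bool =>
        Fin.castAdd n i ∈ (T.comap (Fin.natAdd m)).queries x).card : ℝ) = 0 := by
  rw [Nat.cast_eq_zero, Finset.card_eq_zero, Finset.filter_eq_empty_iff]
  exact fun x _ => castAdd_not_mem_queries_comap_natAdd T x i

/-! ### Squared increments (influences) of block functions -/

/-- **A function of the left block has block-local increments**: for `F(y ⧺ z) = f(y)`,
`Σ_x (F(x^{i→1}) − F(x^{i→0}))² = 2^n · Σ_y (f(y^{i→1}) − f(y^{i→0}))²` at a left coordinate. [folklore] -/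
theorem sum_sq_update_castAdd_of_left (F : (Fin (m + n) → Bool) → ℝ) (f : (Fin m → Bool) → ℝ)
    (hF : ∀ y z, F (Fin.append y z) = f y) (i : Fin m) :
    ∑ x : Fin (m + n) → Bool, (F (update x (Fin.castAdd n i) true) - F (update x (Fin.castAdd n i) false)) ^ 2 =
      (2 : ℝ) ^ n * ∑ y : Fin m → Bool, (f (update y i true) - f (update y i false)) ^ 2 := by
  rw [sum_cube_append, Finset.mul_sum]
  refine Finset.sum_congr rfl fun y _ => ?_
  simp_rw [append_update_castAdd, hF]
  rw [Finset.sum_const, Finset.card_univ, Fintype.card_fun, Fintype.card_bool, Fintype.card_fin, nsmul_eq_mul]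
  push_cast
  rfl

/-- **A function of the left block does not feel right-block flips.** [folklore] -/
theorem sum_sq_update_natAdd_of_left (F : (Fin (m + n) → Bool) → ℝ) (f : (Fin m → Bool) → ℝ)
    (hF : ∀ y z, F (Fin.append y z) = f y) (j : Fin n) :
    ∑ x : Fin (m + n) → Bool, (F (update x (Fin.natAdd m j) true) - F (update x (Fin.natAdd m j) false)) ^ 2 = 0 := by
  rw [sum_cube_append]
  refine Finset.sum_eq_zero fun y _ => Finset.sum_eq_zero fun z _ => ?_
  rw [append_update_natAdd, append_update_natAdd, hF, hF, sub_self]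
  ring

end ClassicalCornerBlockCalculus

end Summit.QuantumAdvantage.QuantumAdvantage.Theorems.SosSandwich
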